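import Literature.NumberTheory.Automorphic.ArchLocalSplitSingularTorusClasses   -- ★ (V8)-sing FILES 1–2 (B-p17 (g23)): (L0), fibre blocks, the `N = 3` count
import HarnessLib

/-!
# Every element of the stable class of a torus point of `U(diag e)(ℂ)` is conjugate to a relabelled torus point — exhaustion for SINGULAR points
# (road D2′ gap «(V8)-exh»; Rogawski 1990 §3.8, §8.3 p. 122)

Topic `NumberTheory/Automorphic`; namespace `Literature.NumberTheory.Automorphic.UnitaryGroup`.  THEOREMS ONLY (no `def`, no instance, no notation,
no axiom, no `sorry`).  Cell `pub/hodgecm-mathlib`, ENGINE T1 (crux H413 = `stmt-HodgeConjecture-24833`); floor-1 preparation, count-neutral, under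
books rows #88 (ST-∞) ∕ #111 (S-d); author B-p17 (g23), FILE 3 of «(V8)-sing» (LEAD F0P3a-plan (g8) WORD T7-5 (11); FILES 1–2 = ★ p838702
`ArchLocalSingularTorusClasses`, ★ p838884 `ArchLocalSplitSingularTorusClasses`).  The `Injective z` case is «(V8)-reg» ★ p838576
`exists_perm_mem_unitaryGroupOfForm_mul_diagonal_of_units` (F0P3a-p02), where the Gram matrix below is already diagonal; here `z` is ARBITRARY.

WHAT IS PROVED.
* §0 **BLOCK SPECTRAL THEOREM** `exists_unitary_blockDiagonal_conjTranspose_mul_mul_eq_diagonal` (any `Fintype n`, any labelling `d : n → ι`): a Hermitian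
  matrix that is block-diagonal along the fibres of `d` is unitarily diagonalised by a unitary that is itself block-diagonal along the fibres
  (Mathlib `Matrix.IsHermitian.eigenvectorUnitary` block by block, assembled with `Matrix.blockDiagonal'` along `n ≃ Σ a, {j ∣ d j = a}` =
  `Equiv.sigmaFiberEquiv`); `mul_diagonal_eq_diagonal_mul_of_fibre` (block-diagonal matrices commute with fibre-constant diagonals).
* §1 **EXHAUSTION** `exists_perm_conj_circleDiagonal_eq_of_conj_eq`: for `e : Fin N → ℝ` with `e_j ≠ 0`, ANY `z : Fin N → Circle`, `δ ∈ U(diag e)(ℂ)` and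
  `g ∈ GL_N(ℂ)` with `g · diag z · g⁻¹ = δ`: `u · diag (z ∘ ρ⁻¹) · u⁻¹ = δ` for some `ρ ∈ S_N`, `u ∈ U(diag e)(ℂ)`.  Route: the Gram matrix
  `G = gᴴ · diag e · g` is Hermitian and commutes with `diag z` (`δ` preserves the form, `diag z` is unitary) ⇒ block-diagonal along the eigenvalue
  fibres (★ FILE 1 `apply_eq_zero_of_mul_diagonal_comm`) ⇒ §0 gives a block-diagonal unitary `W` with `(gW)ᴴ · diag e · (gW) = diag x` real while
  `g W` still intertwines; Sylvester (★ `card_pos_eq_of_conjTranspose_mul_diagonal_mul`) matches the signs of `x` and `e` by a permutation `τ`;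
  the weighted monomial `M(τ, √(e_j ∕ x_{τ j}))` (★ `monomial_conj_circleDiagonal_of_ne_zero`, F0P3a-p06) turns `g W` into `u ∈ U`, `ρ = τ⁻¹`.
* §2 `setOf_conjClasses_conj_circleDiagonal_eq`: the conjugacy classes of `U(diag e)(ℂ)` meeting the stable class of `diag z` are EXACTLY the classes
  of the relabelled torus points; **`ncard_conjClasses_conj_circleDiagonal_eq_two`**: for `N = 3`, `e` indefinite, `z` two-valued — the split-singular
  `γ₀ = diag(a,a,b)` of `U(2,1)` — the stable class of `γ₀` is EXACTLY TWO conjugacy classes (★ FILE 2 + §1), against three through a regular point.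
HONEST LABEL: HC_CM is proved only modulo the printed citations until rung 0 closes; this file is linear algebra and pays nothing by itself.

## References
* [Rogawski1990] J. D. Rogawski, *Automorphic Representations of Unitary Groups in Three Variables*, Ann. of Math. Stud. 123 (1990): §3.1 p. 19
  (stable conjugacy), §3.8 pp. 30–32, Prop. 3.8.1 (classes within a stable class ↔ `𝔇(T∕F)`), §8.2 Prop. 8.2.1 p. 118 ∕ §8.3 p. 122 (the classes
  through regular and singular points of the compact Cartan of `U(2,1)`).
* [HornJohnson2013] R. A. Horn, C. R. Johnson, *Matrix Analysis*, 2nd ed. (2013), §4.1 Thm. 4.1.5 (spectral theorem for Hermitian matrices),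
  §4.5 Thm. 4.5.8 (Sylvester's law of inertia), §0.7 (partitioned matrices).
-/

set_option autoImplicit false

noncomputable section

open Matrix Equiv Finset
open Literature.LinearAlgebra.Matrix
open scoped MatrixGroups ComplexConjugate

namespace Literature.NumberTheory.Automorphic.UnitaryGroup

/-! ## §0 Block spectral theorem: a Hermitian matrix commuting with a labelling is diagonalised by a block-diagonal unitary -/

section BlockSpectral

variable {n : Type*} [Fintype n] [DecidableEq n]

/-- A block-diagonal matrix (vanishing off the fibres of a labelling `d`) commutes with every diagonal matrix constant on the fibres of `d`.
[cite: HornJohnson2013, §0.7 (partitioned matrices)] -/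
theorem mul_diagonal_eq_diagonal_mul_of_fibre {R : Type*} [CommRing R] {ι : Type*} (d : n → ι) (w : Matrix n n R)
    (hw : ∀ i j, d i ≠ d j → w i j = 0) (s : n → R) (hs : ∀ i j, d i = d j → s i = s j) :
    w * diagonal s = diagonal s * w := by
  ext i j
  rw [mul_diagonal, diagonal_mul]
  by_cases hij : d i = d j
  · rw [hs i j hij, mul_comm]
  · rw [hw i j hij, zero_mul, mul_zero]

/-- **BLOCK SPECTRAL THEOREM.**  A Hermitian matrix `G` that is block-diagonal along the fibres of a labelling `d : n → ι` (`G i j = 0` for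
`d i ≠ d j`) is unitarily diagonalised by a unitary `W` that is ITSELF block-diagonal along the same fibres: `W · Wᴴ = 1`, `W i j = 0` off the
fibres, `Wᴴ · G · W = diag x` with `x` real (Mathlib `Matrix.IsHermitian.eigenvectorUnitary` block by block, assembled with `Matrix.blockDiagonal'`
along `n ≃ Σ a, {j ∣ d j = a}`). [cite: HornJohnson2013, §4.1 Thm 4.1.5 (spectral theorem); §0.7] -/
theorem exists_unitary_blockDiagonal_conjTranspose_mul_mul_eq_diagonal {ι : Type*} (d : n → ι) (G : Matrix n n ℂ) (hG : G.IsHermitian)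
    (hGd : ∀ i j, d i ≠ d j → G i j = 0) :
    ∃ W : Matrix n n ℂ, W * Wᴴ = 1 ∧ Wᴴ * W = 1 ∧ (∀ i j, d i ≠ d j → W i j = 0) ∧
      ∃ x : n → ℝ, Wᴴ * G * W = diagonal (fun i => (x i : ℂ)) := by
  classical
  -- block labels and the reindexing `n ≃ Σ k, fibre k`
  let o := {a : ι // a ∈ Finset.univ.image d}
  haveI : Fintype o := inferInstanceAs (Fintype {a : ι // a ∈ Finset.univ.image d})
  haveI : DecidableEq o := inferInstanceAs (DecidableEq {a : ι // a ∈ Finset.univ.image d})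
  let d' : n → o := fun j => ⟨d j, Finset.mem_image_of_mem d (Finset.mem_univ j)⟩
  haveI : ∀ k : o, Fintype {j // d' j = k} := fun k => inferInstance
  let σ : (Σ k : o, {j // d' j = k}) ≃ n := Equiv.sigmaFiberEquiv d'
  have hσ : ∀ x : Σ k : o, {j // d' j = k}, σ x = x.2.1 := fun _ => rfl
  have hdd' : ∀ i j, d' i = d' j ↔ d i = d j := fun i j => by
    constructor
    · intro h; exact congrArg Subtype.val h
    · intro h; exact Subtype.ext h
  -- the diagonal blocks and their unitary diagonalisations
  let B : ∀ k : o, Matrix {j // d' j = k} {j // d' j = k} ℂ := fun k => G.submatrix (fun j => j.1) (fun j => j.1)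
  have hB : ∀ k, (B k).IsHermitian := fun k => hG.submatrix _
  let U : ∀ k : o, Matrix {j // d' j = k} {j // d' j = k} ℂ := fun k => ((hB k).eigenvectorUnitary : Matrix _ _ ℂ)
  have hUU : ∀ k, U k * (U k)ᴴ = 1 := fun k => by
    rw [← star_eq_conjTranspose]; exact Unitary.coe_mul_star_self _
  have hUU' : ∀ k, (U k)ᴴ * U k = 1 := fun k => by
    rw [← star_eq_conjTranspose]; exact Unitary.coe_star_mul_self _
  have hUB : ∀ k, (U k)ᴴ * B k * U k = diagonal (fun i => ((hB k).eigenvalues i : ℂ)) := fun k => by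
    have h1 := (hB k).conjStarAlgAut_star_eigenvectorUnitary
    rw [Unitary.conjStarAlgAut_star_apply, star_eq_conjTranspose] at h1
    rw [h1]
    rfl
  -- `G` in `Σ`-coordinates is the block-diagonal matrix of its diagonal blocks
  have hGσ : G.submatrix σ σ = blockDiagonal' B := by
    ext ⟨k, i⟩ ⟨k', j⟩
    rw [submatrix_apply, hσ, hσ, blockDiagonal'_apply']
    split_ifs with h
    · subst h; rfl
    · exact hGd _ _ fun hd => h (i.2.symm.trans (((hdd' _ _).mpr hd).trans j.2))
  -- the block-diagonal unitary, reindexed back to `n`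
  have hWσ1 : blockDiagonal' U * (blockDiagonal' U)ᴴ = 1 := by
    rw [blockDiagonal'_conjTranspose, ← blockDiagonal'_mul]
    simp_rw [hUU]
    exact blockDiagonal'_one
  have hWσ2 : (blockDiagonal' U)ᴴ * blockDiagonal' U = 1 := by
    rw [blockDiagonal'_conjTranspose, ← blockDiagonal'_mul]
    simp_rw [hUU']
    exact blockDiagonal'_one
  have hWσG : (blockDiagonal' U)ᴴ * blockDiagonal' B * blockDiagonal' U = diagonal (fun ki : Σ k : o, {j // d' j = k} => ((hB ki.1).eigenvalues ki.2 : ℂ)) := by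
    rw [blockDiagonal'_conjTranspose, ← blockDiagonal'_mul, ← blockDiagonal'_mul]
    simp_rw [hUB]
    exact blockDiagonal'_diagonal _
  refine ⟨(blockDiagonal' U).submatrix σ.symm σ.symm, ?_, ?_, ?_, fun j => (hB (σ.symm j).1).eigenvalues (σ.symm j).2, ?_⟩
  · rw [conjTranspose_submatrix, submatrix_mul_equiv, hWσ1, submatrix_one_equiv]
  · rw [conjTranspose_submatrix, submatrix_mul_equiv, hWσ2, submatrix_one_equiv]
  · intro i j hij
    rw [submatrix_apply]
    change blockDiagonal' U ⟨d' i, ⟨i, rfl⟩⟩ ⟨d' j, ⟨j, rfl⟩⟩ = 0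
    exact blockDiagonal'_apply_ne U _ _ fun h => hij ((hdd' i j).mp h)
  · have hGback : G = (blockDiagonal' B).submatrix σ.symm σ.symm := by
      rw [← hGσ, submatrix_submatrix, Equiv.self_comp_symm, submatrix_id_id]
    rw [hGback, conjTranspose_submatrix, submatrix_mul_equiv, submatrix_mul_equiv, hWσG, submatrix_diagonal_equiv]
    rfl

end BlockSpectral

/-! ## §1 Exhaustion: every element of `U(diag e)(ℂ)` in the stable class of a torus point is `U`-conjugate to a relabelled torus point -/

section Exhaustion

variable (N : ℕ)

/-- Fibre matching (private copy of the FILE 1 plumbing): two labellings with fibres of equal sizes differ by a permutation. [folklore] -/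
private theorem exists_perm_forall_apply_eq' {n : Type*} [Fintype n] {ι : Type*} [DecidableEq ι] (f g : n → ι)
    (h : ∀ a, (univ.filter fun j => f j = a).card = (univ.filter fun j => g j = a).card) :
    ∃ π : Equiv.Perm n, ∀ j, g (π j) = f j := by
  have hc : ∀ a, Fintype.card {j // f j = a} = Fintype.card {j // g j = a} := fun a => by
    rw [Fintype.card_subtype, Fintype.card_subtype, h a]
  exact ⟨Equiv.ofFiberEquiv (f := f) (g := g) fun a => Fintype.equivOfCardEq (hc a), fun j => Equiv.ofFiberEquiv_map _ j⟩

/-- Sign matching (private): two real vectors with no zero entry and the same number of positive entries are matched by a permutation.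
[folklore] -/
private theorem exists_perm_pos_iff {n : Type*} [Fintype n] (x e : n → ℝ) (hx : ∀ j, x j ≠ 0) (he : ∀ j, e j ≠ 0)
    (h : (univ.filter fun j => 0 < e j).card = (univ.filter fun j => 0 < x j).card) :
    ∃ τ : Equiv.Perm n, ∀ j, 0 < e j / x (τ j) := by
  classical
  obtain ⟨τ, hτ⟩ := exists_perm_forall_apply_eq' (fun j => decide (0 < e j)) (fun j => decide (0 < x j)) (by
    intro b
    cases b
    · have hce := Finset.card_filter_add_card_filter_not (s := (univ : Finset n)) (fun j => 0 < e j)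
      have hcx := Finset.card_filter_add_card_filter_not (s := (univ : Finset n)) (fun j => 0 < x j)
      have h' : (univ.filter fun j => ¬ 0 < e j).card = (univ.filter fun j => ¬ 0 < x j).card := by omega
      convert h' using 2 <;> · ext j; simp
    · convert h using 2 <;> · ext j; simp)
  refine ⟨τ, fun j => ?_⟩
  have hj : (0 < x (τ j) ↔ 0 < e j) := by simpa using hτ j
  rcases lt_or_gt_of_ne (he j) with hneg | hpos
  · exact div_pos_of_neg_of_neg hneg (lt_of_le_of_ne (not_lt.mp fun hh => (lt_irrefl _ (hneg.trans (hj.mp hh))).elim) (hx _))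
  · exact div_pos hpos (hj.mpr hpos)

/-- **EXHAUSTION — EVERY ELEMENT OF THE STABLE CLASS OF A TORUS POINT IS `U`-CONJUGATE TO A RELABELLED TORUS POINT**, for an ARBITRARY (possibly
singular) torus point `diag z`: if `δ ∈ U(diag e)(ℂ)` (`e` real, `e_j ≠ 0`) and `g · diag z · g⁻¹ = δ` for some `g ∈ GL_N(ℂ)`, then `u · diag (z ∘ ρ⁻¹) · u⁻¹ = δ`
for some permutation `ρ` and some `u ∈ U(diag e)(ℂ)`.  Mechanism: the Gram matrix `G = gᴴ · diag e · g` is Hermitian and COMMUTES with `diag z` (`δ` preserves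
the form and `diag z` is unitary), hence is block-diagonal along the eigenvalue fibres (eigenspaces for distinct unimodular eigenvalues are
`diag e`-orthogonal); the block spectral theorem (§0) gives a block-diagonal unitary `W` — so `g W` still intertwines `diag z` with `δ` — with
`(gW)ᴴ · diag e · (gW) = diag x` real; Sylvester (★ `card_pos_eq_of_conjTranspose_mul_diagonal_mul`) matches the signs of `x` and `e` by a permutation
`τ`, and the weighted monomial `M(τ, √(e_j ∕ x_{τ j}))` (★ p06 `monomial_conj_circleDiagonal_of_ne_zero`) turns `g W` into an element of `U`.
(«(V8)-reg» ★ `exists_perm_mem_unitaryGroupOfForm_mul_diagonal_of_units` is the `Injective z` case, where `G` is already diagonal.)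
[cite: Rogawski1990, §3.8 pp. 30–32 (Prop. 3.8.1); §8.3 p. 122 (§8.2 Prop. 8.2.1 p. 118)] [cite: HornJohnson2013, §4.5 Thm 4.5.8 (Sylvester); §4.1 Thm 4.1.5] -/
theorem exists_perm_conj_circleDiagonal_eq_of_conj_eq {e : Fin N → ℝ} (he : ∀ j, e j ≠ 0) (z : Fin N → Circle)
    {δ : GL (Fin N) ℂ} (hδU : δ ∈ unitaryGroupOfForm (starRingEnd ℂ) (Matrix.diagonal fun j => (e j : ℂ))) (g : GL (Fin N) ℂ)
    (h : g * circleDiagonal N z * g⁻¹ = δ) :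
    ∃ ρ : Perm (Fin N), ∃ u : unitaryGroupOfForm (starRingEnd ℂ) (Matrix.diagonal fun j => (e j : ℂ)),
      (u : GL (Fin N) ℂ) * circleDiagonal N (fun i => z (ρ.symm i)) * (u : GL (Fin N) ℂ)⁻¹ = δ := by
  classical
  have hct : ∀ A : Matrix (Fin N) (Fin N) ℂ, (A.map (starRingEnd ℂ))ᵀ = Aᴴ := fun _ => rfl
  have hgt : (g : Matrix (Fin N) (Fin N) ℂ) * diagonal (fun j => (z j : ℂ)) = (δ : Matrix (Fin N) (Fin N) ℂ) * (g : Matrix (Fin N) (Fin N) ℂ) := by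
    have h1 := congrArg (fun u : GL (Fin N) ℂ => (u : Matrix (Fin N) (Fin N) ℂ)) (mul_inv_eq_iff_eq_mul.mp h)
    simpa only [Units.val_mul, coe_circleDiagonal] using h1
  have hδ : (δ : Matrix (Fin N) (Fin N) ℂ)ᴴ * diagonal (fun j => (e j : ℂ)) * (δ : Matrix (Fin N) (Fin N) ℂ) = diagonal (fun j => (e j : ℂ)) := by
    rw [← hct]; exact mem_unitaryGroupOfForm_iff.mp hδU
  -- notation: `t = diag z`, `G = gᴴ · diag e · g` (the Gram matrix of the form in the columns of `g`)
  set t : Matrix (Fin N) (Fin N) ℂ := diagonal fun j => (z j : ℂ) with ht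
  set G : Matrix (Fin N) (Fin N) ℂ := (g : Matrix (Fin N) (Fin N) ℂ)ᴴ * diagonal (fun j => (e j : ℂ)) * (g : Matrix (Fin N) (Fin N) ℂ) with hG
  -- (E1) `G` is Hermitian and commutes with `t`
  have hDh : (diagonal fun j => (e j : ℂ)).IsHermitian := by
    refine isHermitian_diagonal_of_self_adjoint _ ?_
    change star (fun j => (e j : ℂ)) = fun j => (e j : ℂ)
    funext j
    simp only [Pi.star_apply, Complex.star_def, Complex.conj_ofReal]
  have hGh : G.IsHermitian := isHermitian_conjTranspose_mul_mul _ hDh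
  have htt : t * tᴴ = 1 := by
    rw [ht, diagonal_conjTranspose, diagonal_mul_diagonal, ← diagonal_one]
    congr 1
    funext j
    rw [Pi.star_apply, Complex.star_def, Complex.mul_conj, Circle.normSq_coe, Complex.ofReal_one]
  have htGt : tᴴ * G * t = G := by
    calc tᴴ * G * t = ((g : Matrix (Fin N) (Fin N) ℂ) * t)ᴴ * diagonal (fun j => (e j : ℂ)) * ((g : Matrix (Fin N) (Fin N) ℂ) * t) := by
          rw [hG, conjTranspose_mul]; simp only [Matrix.mul_assoc]
      _ = ((δ : Matrix (Fin N) (Fin N) ℂ) * (g : Matrix (Fin N) (Fin N) ℂ))ᴴ * diagonal (fun j => (e j : ℂ)) *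
            ((δ : Matrix (Fin N) (Fin N) ℂ) * (g : Matrix (Fin N) (Fin N) ℂ)) := by rw [hgt]
      _ = (g : Matrix (Fin N) (Fin N) ℂ)ᴴ * ((δ : Matrix (Fin N) (Fin N) ℂ)ᴴ * diagonal (fun j => (e j : ℂ)) * (δ : Matrix (Fin N) (Fin N) ℂ)) *
            (g : Matrix (Fin N) (Fin N) ℂ) := by
          rw [conjTranspose_mul]; simp only [Matrix.mul_assoc]
      _ = G := by rw [hδ, hG]
  have hGt : G * t = t * G := by
    calc G * t = t * tᴴ * G * t := by rw [htt, Matrix.one_mul]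
      _ = t * (tᴴ * G * t) := by simp only [Matrix.mul_assoc]
      _ = t * G := by rw [htGt]
  have hGz : ∀ i j, z i ≠ z j → G i j = 0 := fun i j hij =>
    apply_eq_zero_of_mul_diagonal_comm hGt fun hc => hij (Circle.ext hc)
  -- (E2) block spectral theorem along the fibres of `z`
  obtain ⟨W, hWW, hWW', hWz, x, hWGW⟩ := exists_unitary_blockDiagonal_conjTranspose_mul_mul_eq_diagonal z G hGh hGz
  have hWt : W * t = t * W := mul_diagonal_eq_diagonal_mul_of_fibre z W hWz _ fun i j hij => by rw [hij]
  -- (E3) `g' = g W` still intertwines `t` with `δ`, and has the DIAGONAL Gram matrix `diag x`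
  let Wu : GL (Fin N) ℂ := ⟨W, Wᴴ, hWW, hWW'⟩
  set g' : Matrix (Fin N) (Fin N) ℂ := (g : Matrix (Fin N) (Fin N) ℂ) * W with hg'
  have hg'val : ((g * Wu : GL (Fin N) ℂ) : Matrix (Fin N) (Fin N) ℂ) = g' := by rw [Units.val_mul]
  have hg'D : g'ᴴ * diagonal (fun j => (e j : ℂ)) * g' = diagonal (fun j => (x j : ℂ)) := by
    calc g'ᴴ * diagonal (fun j => (e j : ℂ)) * g' = Wᴴ * G * W := by rw [hg', hG, conjTranspose_mul]; simp only [Matrix.mul_assoc]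
      _ = diagonal (fun j => (x j : ℂ)) := hWGW
  have hg'unit : IsUnit g' := by rw [← hg'val]; exact Units.isUnit _
  haveI : Invertible g' := hg'unit.invertible
  -- `x` has no zero entry (`det (g'ᴴ · diag e · g') ≠ 0`)
  have hx : ∀ j, x j ≠ 0 := by
    have hdet := congrArg Matrix.det hg'D
    rw [det_mul, det_mul, det_conjTranspose, det_diagonal, det_diagonal] at hdet
    have hg'det : g'.det ≠ 0 := ((Matrix.isUnit_iff_isUnit_det _).mp hg'unit).ne_zero
    have hne : (∏ j, (x j : ℂ)) ≠ 0 := by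
      rw [← hdet]
      refine mul_ne_zero (mul_ne_zero ?_ (Finset.prod_ne_zero_iff.mpr fun j _ => Complex.ofReal_ne_zero.mpr (he j))) hg'det
      rwa [Complex.star_def, map_ne_zero]
    intro j hj
    exact hne (Finset.prod_eq_zero (Finset.mem_univ j) (by rw [hj, Complex.ofReal_zero]))
  -- (E4) Sylvester + (E5) a sign-matching relabelling `τ`
  have hS := card_pos_eq_of_conjTranspose_mul_diagonal_mul e x g' hg'D
  obtain ⟨τ, hτ⟩ := exists_perm_pos_iff x e hx he hS
  -- (E6) the weighted monomial `M = M(τ, c)`, `c_j = √(e_j ∕ x_{τ j})`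
  set c : Fin N → ℂ := fun j => ((Real.sqrt (e j / x (τ j)) : ℝ) : ℂ) with hc
  have hcne : ∀ j, c j ≠ 0 := fun j => by
    simp only [hc, ne_eq, Complex.ofReal_eq_zero]
    exact (Real.sqrt_pos.mpr (hτ j)).ne'
  have hMdet := det_monomial_ne_zero N τ hcne
  -- `M(τ,c)ᴴ · diag x · M(τ,c) = diag e`
  have hMx : (monomial τ c)ᴴ * diagonal (fun j => (x j : ℂ)) * monomial τ c = diagonal (fun j => (e j : ℂ)) := by
    rw [conjTranspose_monomial, monomial_mul_diagonal, monomial_mul_monomial, inv_mul_cancel, monomial_one]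
    congr 1
    funext j
    rw [Perm.inv_def, Equiv.symm_apply_apply]
    have hreal : star (c j) = c j := by simp [hc, Complex.conj_ofReal]
    have hsq : Real.sqrt (e j / x (τ j)) * Real.sqrt (e j / x (τ j)) = e j / x (τ j) := Real.mul_self_sqrt (hτ j).le
    have hxj : (x (τ j) : ℂ) ≠ 0 := Complex.ofReal_ne_zero.mpr (hx _)
    rw [hreal, hc]
    calc ((Real.sqrt (e j / x (τ j)) : ℝ) : ℂ) * (x (τ j) : ℂ) * ((Real.sqrt (e j / x (τ j)) : ℝ) : ℂ)
        = ((Real.sqrt (e j / x (τ j)) * Real.sqrt (e j / x (τ j)) : ℝ) : ℂ) * (x (τ j) : ℂ) := by push_cast; ring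
      _ = (e j : ℂ) := by rw [hsq]; push_cast; rw [div_mul_cancel₀ _ hxj]
  -- `M(τ,c)⁻¹ · diag z · M(τ,c) = diag (z ∘ τ)` (★ `monomial_conj_circleDiagonal_of_ne_zero`)
  have hMz : (Matrix.GeneralLinearGroup.mkOfDetNeZero _ hMdet)⁻¹ * circleDiagonal N z * Matrix.GeneralLinearGroup.mkOfDetNeZero _ hMdet =
      circleDiagonal N (fun i => z (τ i)) := by
    have h1 := monomial_conj_circleDiagonal_of_ne_zero N τ hMdet (fun i => z (τ i))
    have h2 : (fun i => (fun i => z (τ i)) (τ.symm i)) = z := funext fun i => by simp only [Equiv.apply_symm_apply]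
    rw [h2] at h1
    rw [← h1]
    simp only [mul_assoc, inv_mul_cancel_left, inv_mul_cancel, mul_one]
  have hWcomm : Wu * circleDiagonal N z = circleDiagonal N z * Wu := by
    apply Units.ext
    simp only [Units.val_mul, coe_circleDiagonal]
    exact hWt
  -- the conjugator `u = g · W · M(τ,c)` and the relabelling `ρ = τ⁻¹`
  refine ⟨τ⁻¹, ⟨g * Wu * Matrix.GeneralLinearGroup.mkOfDetNeZero _ hMdet, ?_⟩, ?_⟩
  · -- membership: `uᴴ · diag e · u = Mᴴ (g'ᴴ · diag e · g') M = Mᴴ · diag x · M = diag e`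
    rw [mem_unitaryGroupOfForm_iff, hct, Units.val_mul, hg'val, conjTranspose_mul, Matrix.GeneralLinearGroup.val_mkOfDetNeZero]
    calc (monomial τ c)ᴴ * g'ᴴ * diagonal (fun j => (e j : ℂ)) * (g' * monomial τ c)
        = (monomial τ c)ᴴ * (g'ᴴ * diagonal (fun j => (e j : ℂ)) * g') * monomial τ c := by simp only [Matrix.mul_assoc]
      _ = diagonal (fun j => (e j : ℂ)) := by rw [hg'D, hMx]
  · -- conjugation: `u · diag (z ∘ τ) · u⁻¹ = g W (M · diag (z ∘ τ) · M⁻¹) W⁻¹ g⁻¹ = g W · diag z · W⁻¹ g⁻¹ = g · diag z · g⁻¹ = δ`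
    have hρ : (fun i => z ((τ⁻¹ : Perm (Fin N)).symm i)) = fun i => z (τ i) := by
      funext i; rw [Perm.inv_def, Equiv.symm_symm]
    change g * Wu * Matrix.GeneralLinearGroup.mkOfDetNeZero _ hMdet * circleDiagonal N (fun i => z ((τ⁻¹ : Perm (Fin N)).symm i)) *
        (g * Wu * Matrix.GeneralLinearGroup.mkOfDetNeZero _ hMdet)⁻¹ = δ
    rw [hρ, ← hMz, ← h]
    calc g * Wu * Matrix.GeneralLinearGroup.mkOfDetNeZero _ hMdet *
          ((Matrix.GeneralLinearGroup.mkOfDetNeZero _ hMdet)⁻¹ * circleDiagonal N z * Matrix.GeneralLinearGroup.mkOfDetNeZero _ hMdet) *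
          (g * Wu * Matrix.GeneralLinearGroup.mkOfDetNeZero _ hMdet)⁻¹
        = g * (Wu * circleDiagonal N z) * Wu⁻¹ * g⁻¹ := by
          simp only [_root_.mul_inv_rev, mul_assoc, mul_inv_cancel_left]
      _ = g * circleDiagonal N z * g⁻¹ := by rw [hWcomm]; simp only [mul_assoc, mul_inv_cancel_left]

end Exhaustion

/-! ## §2 The stable class of a torus point, read on conjugacy classes of `U(diag e)(ℂ)`; the split-singular count -/

section Classes

variable (N : ℕ)

/-- Conjugacy classes of a subgroup, read on the ambient group (private plumbing). [folklore] -/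
private theorem conjClasses_mk_eq_mk_iff_exists_coe_conj'' {G : Type*} [Group G] {H : Subgroup G} (x y : H) :
    ConjClasses.mk x = ConjClasses.mk y ↔ ∃ g : H, (g : G) * (x : G) * (g : G)⁻¹ = y := by
  rw [ConjClasses.mk_eq_mk_iff_isConj, isConj_iff]
  constructor
  · rintro ⟨c, hc⟩
    exact ⟨c, by rw [← hc, Subgroup.coe_mul, Subgroup.coe_mul, Subgroup.coe_inv]⟩
  · rintro ⟨g, hg⟩
    exact ⟨g, Subtype.ext (by rw [Subgroup.coe_mul, Subgroup.coe_mul, Subgroup.coe_inv]; exact hg)⟩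

/-- **THE STABLE CLASS OF A TORUS POINT, CLASS BY CLASS**: the conjugacy classes of `U(diag e)(ℂ)` (`e_j ≠ 0`) meeting the stable (= `GL_N(ℂ)`-)
class of the torus point `diag z` — `z` ARBITRARY — are exactly the classes of the relabelled torus points `diag (z ∘ ρ⁻¹)`, `ρ ∈ S_N`
(⊆ by the exhaustion theorem, ⊇ by ★ `monomial_conj_circleDiagonal`).  With ★ FILE 1 (C‴) the classes are then read off the sign distributions.
[cite: Rogawski1990, §3.8 pp. 30–32 (Prop. 3.8.1); §3.1 p. 19] -/
theorem setOf_conjClasses_conj_circleDiagonal_eq {e : Fin N → ℝ} (he : ∀ j, e j ≠ 0) (z : Fin N → Circle) :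
    {q : ConjClasses (unitaryGroupOfForm (starRingEnd ℂ) (Matrix.diagonal fun j => (e j : ℂ))) |
        ∃ δ : unitaryGroupOfForm (starRingEnd ℂ) (Matrix.diagonal fun j => (e j : ℂ)), ∃ g : GL (Fin N) ℂ,
          ConjClasses.mk δ = q ∧ g * circleDiagonal N z * g⁻¹ = (δ : GL (Fin N) ℂ)} =
      {q | ∃ ρ : Perm (Fin N), q = ConjClasses.mk ⟨circleDiagonal N (fun i => z (ρ.symm i)),
          circleDiagonal_mem_unitaryGroupOfForm_diagonal N _ _⟩} := by
  ext q
  simp only [Set.mem_setOf_eq]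
  constructor
  · rintro ⟨δ, g, rfl, hg⟩
    obtain ⟨ρ, u, hu⟩ := exists_perm_conj_circleDiagonal_eq_of_conj_eq N he z δ.2 g hg
    refine ⟨ρ, Eq.symm ?_⟩
    exact (conjClasses_mk_eq_mk_iff_exists_coe_conj''
      (⟨circleDiagonal N (fun i => z (ρ.symm i)), circleDiagonal_mem_unitaryGroupOfForm_diagonal N _ _⟩ :
        unitaryGroupOfForm (starRingEnd ℂ) (Matrix.diagonal fun j => (e j : ℂ))) δ).mpr ⟨u, hu⟩
  · rintro ⟨ρ, rfl⟩
    exact ⟨_, Matrix.GeneralLinearGroup.mkOfDetNeZero _ (det_monomial_one_ne_zero N ρ), rfl, monomial_conj_circleDiagonal N ρ z⟩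

/-- **EXACTLY TWO CONJUGACY CLASSES IN THE STABLE CLASS OF THE SPLIT-SINGULAR POINT `γ₀ = diag(a,a,b)` OF `U(2,1)`**: for `e : Fin 3 → ℝ`
indefinite with no zero entry and a two-valued torus point `diag z` (singular slot `k`), the classes of `U(diag e)(ℂ)` whose members are
`GL₃(ℂ)`-conjugate (= stably conjugate, ★ `Rogawski1990.isStablyConj_iff`) to `diag z` are EXACTLY TWO (★ FILE 2
`ncard_conjClasses_circleDiagonal_perm_eq_two` + the exhaustion above) — Rogawski's count through the singular point of the compact Cartan,
against THREE through a regular point («(V8)-reg» ★ `ncard_conjClasses_stable_circleDiagonal`).  At a complex CM place `w` this is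
`G_w = archLocal L 3 (diagonal α) w` with `e = re ∘ σ_w ∘ α`. [cite: Rogawski1990, §8.3 p. 122 (§8.2 Prop. 8.2.1 p. 118); §3.8 pp. 30–32 (Prop. 3.8.1)] -/
theorem ncard_conjClasses_conj_circleDiagonal_eq_two {e : Fin 3 → ℝ} (he : ∀ j, e j ≠ 0) (hind : ∃ i j, 0 < e i ∧ e j < 0)
    {z : Fin 3 → Circle} {k : Fin 3} (hk : ∀ j, z j = z k ↔ j = k) (hzz : ∀ i j, i ≠ k → j ≠ k → z i = z j) :
    {q : ConjClasses (unitaryGroupOfForm (starRingEnd ℂ) (Matrix.diagonal fun j => (e j : ℂ))) |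
        ∃ δ : unitaryGroupOfForm (starRingEnd ℂ) (Matrix.diagonal fun j => (e j : ℂ)), ∃ g : GL (Fin 3) ℂ,
          ConjClasses.mk δ = q ∧ g * circleDiagonal 3 z * g⁻¹ = (δ : GL (Fin 3) ℂ)}.ncard = 2 := by
  rw [setOf_conjClasses_conj_circleDiagonal_eq 3 he z]
  exact ncard_conjClasses_circleDiagonal_perm_eq_two he hind hk hzz

end Classes

end Literature.NumberTheory.Automorphic.UnitaryGroup
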